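import Mathlib
import HarnessLib
import Summits.HubbardSuperconductivity.HubbardSuperconductivity.Theorems.KLProgrammeFermiSurfaceUmklapp
import Summits.HubbardSuperconductivity.HubbardSuperconductivity.Theorems.KLProgrammeFermiSeaConvex

/-!
# Route `KLProgramme` (cruxes K1/K3, DECOMP C4b / App. A, p4's COUNTING-NOTE-2): the umklapp corner is
# STRICTLY TRANSVERSAL — a closed form for the angle between the bundle and the anchored leg

Cell `gate-hubbard-kl`, risk-register item r2. At an umklapp corner of the free band Fermi curve
`F_μ = {ε = μ}`, `ε(k) = -2(cos k₁ + cos k₂)`, three momenta sit near one curve point `p = p_μ(θ*)`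
(`0 < θ* < π/4`, `KLProgrammeFermiSurfaceUmklapp.klfs_exists_corner`) and the fourth, anchored leg near
`k* = 2πG - 3p ∈ F_μ`. COUNTING-NOTE-2 (p4, 2026-08-26) observes that the anisotropic relative sector count
(BGM 2006 Lemma A3.1) degrades at a corner exactly because the anchored leg is TRANSVERSAL to the bundle.
Here is the geometry as a theorem, with a closed form: the gradients `∇ε = 2(sin k₁, sin k₂)` at `p = (x, y)`
and at `3p` (`≡ ±k*` modulo `2πℤ²` and sign, same gradient up to sign) satisfy

  `det(∇ε(p), ∇ε(3p))/4 = sin x · sin 3y - sin y · sin 3x = 4 sin x sin y (sin²x - sin²y)`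

(`klfs_cross_sin_three_mul`), which is STRICTLY POSITIVE whenever `0 < y < x` and `x + y < π`
(`klfs_cross_sin_three_mul_pos`) — in particular at every point `p_μ(θ)` of the first open octant
`0 < θ < π/4` of the curve, `-4 < μ < 0` (`klfs_corner_transversal`; the curve lies in the open diamond
`|x| + |y| < π`). So the bundle direction and the anchored leg are never parallel at a corner; the node
(`θ = π/4`, `x = y`) and the antinode (`y = 0`), where the determinant vanishes, are never corners
(`klfs_lt_rayDispersion_triple_node`, `klfs_rayDispersion_triple_antinode_lt`). Numerically the factor
`sin²x - sin²y` at the certified corner angles `θ* ∈ [0.121π, 0.128π]` of HOME/FS-WINDOW.md §2 is what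
U7 / S2′ (DECOMP App. D) should carry as the corner transversality constant — and §4 gives it in
CLOSED FORM: the corner equations are solvable (`klfs_corner_cos_eq`: `cos x₁ = (m-s)/2`, `cos y₁ = (m+s)/2`,
`m = -μ/2`, `s = √((4-m²)/3)`), so the corner is unique (`klfs_corner_unique`), `sin²x₁ - sin²y₁ = m·s`
(`klfs_corner_transversality_factor`), `≥ 0.103` / `≥ 0.083` on the certified / analysis window
(`klfs_windows_corner_transversality_factor_ge`). No definitions; everything PROVED. [folklore]
-/

noncomputable section

open Real Set

-- the tree's namespace `Summit.<Summit>.<Problem>.Theorems` repeats the summit name by design (D-0017)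
set_option linter.dupNamespace false

namespace Summit.HubbardSuperconductivity.HubbardSuperconductivity.Theorems

open Literature.MathematicalPhysics.QuantumLattice

/-- **The corner determinant in closed form**: `sin x sin 3y - sin y sin 3x = 4 sin x sin y (sin²x - sin²y)`
(`sin 3t = 3 sin t - 4 sin³t`). [folklore] -/
theorem klfs_cross_sin_three_mul (x y : ℝ) :
    Real.sin x * Real.sin (3 * y) - Real.sin y * Real.sin (3 * x) =
      4 * Real.sin x * Real.sin y * (Real.sin x ^ 2 - Real.sin y ^ 2) := by
  rw [Real.sin_three_mul, Real.sin_three_mul]; ring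

/-- `0 < sin y < sin x` for `0 < y < x`, `x + y < π` (reflect `x ↦ π - x` if `x > π/2`). [folklore] -/
theorem klfs_sin_lt_sin_of_diamond {x y : ℝ} (hy : 0 < y) (hyx : y < x) (hsum : x + y < π) :
    0 < Real.sin y ∧ Real.sin y < Real.sin x := by
  have hyπ : y < π := by linarith
  refine ⟨Real.sin_pos_of_pos_of_lt_pi hy hyπ, ?_⟩
  rcases le_or_gt x (π / 2) with hx | hx
  · exact Real.sin_lt_sin_of_lt_of_le_pi_div_two (by linarith) hx hyx
  · rw [← Real.sin_pi_sub x]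
    exact Real.sin_lt_sin_of_lt_of_le_pi_div_two (by linarith) (by linarith) (by linarith)

/-- **Strict positivity of the corner determinant** on `0 < y < x`, `x + y < π`. [folklore] -/
theorem klfs_cross_sin_three_mul_pos {x y : ℝ} (hy : 0 < y) (hyx : y < x) (hsum : x + y < π) :
    0 < Real.sin x * Real.sin (3 * y) - Real.sin y * Real.sin (3 * x) := by
  rw [klfs_cross_sin_three_mul]
  obtain ⟨h1, h2⟩ := klfs_sin_lt_sin_of_diamond hy hyx hsum
  have h3 : 0 < Real.sin x := h1.trans h2
  have h4 : 0 < Real.sin x ^ 2 - Real.sin y ^ 2 := by nlinarith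
  positivity

/-- A first-octant curve point `p_μ(θ) = (x, y)`, `0 < θ < π/4`, `-4 < μ < 0`, has `0 < y < x` and
`x + y < π` (the curve lies in the open diamond). [folklore] -/
theorem klfs_octant_point {μ : ℝ} (hμ₁ : -4 < μ) (hμ₂ : μ < 0) {θ : ℝ} (hθ : θ ∈ Ioo (0 : ℝ) (π / 4)) :
    0 < bandY μ θ ∧ bandY μ θ < bandX μ θ ∧ bandX μ θ + bandY μ θ < π := by
  have hu := bandFermiRadius_pos hμ₁ hμ₂ θ
  have hs : 0 < Real.sin θ := Real.sin_pos_of_pos_of_lt_pi hθ.1 (by linarith [hθ.2, Real.pi_pos])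
  have hsc : Real.sin θ < Real.cos θ := by
    rw [← Real.sin_pi_div_two_sub]
    exact Real.sin_lt_sin_of_lt_of_le_pi_div_two (by linarith [hθ.1, Real.pi_pos]) (by linarith [hθ.1])
      (by linarith [hθ.2])
  have h1 : 0 < bandY μ θ := by unfold bandY; positivity
  have h2 : bandY μ θ < bandX μ θ := by
    unfold bandX bandY; exact mul_lt_mul_of_pos_left hsc hu
  have hlev : 0 < Real.cos (bandX μ θ) + Real.cos (bandY μ θ) := by
    have h := BandSectorCounting.eps2_bandXY hμ₁ hμ₂ θ
    unfold BandSectorCounting.eps2 at h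
    linarith
  have hK := umklappRadius_lt_pi hμ₂
  have hX : |bandX μ θ| ≤ π := ((BandSectorCounting.abs_bandX_le_umklappRadius hμ₁ hμ₂ θ).trans hK.le)
  have hY : |bandY μ θ| ≤ π := ((BandSectorCounting.abs_bandY_le_umklappRadius hμ₁ hμ₂ θ).trans hK.le)
  have h3 := abs_add_abs_lt_pi_of_cos_add_cos_pos hX hY hlev
  rw [abs_of_pos (h1.trans h2), abs_of_pos h1] at h3
  exact ⟨h1, h2, h3⟩

/-- **Corner transversality** (free band, `-4 < μ < 0`): at every first-octant point `p = p_μ(θ) = (x, y)`,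
`0 < θ < π/4` — in particular at every umklapp corner `θ*` of `klfs_exists_corner` — the gradients of `ε` at
`p` and at `3p` are NOT parallel: `sin x sin 3y - sin y sin 3x > 0`, i.e. `det(∇ε(p), ∇ε(3p)) > 0` with
`∇ε = 2(sin k₁, sin k₂)` (`2πℤ²`-periodic and odd, so the same holds for the anchored leg
`k* = 2πG - 3p` up to sign). The bundle of three legs at `p` and the anchored leg are strictly transversal.
[folklore] -/
theorem klfs_corner_transversal {μ : ℝ} (hμ₁ : -4 < μ) (hμ₂ : μ < 0) {θ : ℝ} (hθ : θ ∈ Ioo (0 : ℝ) (π / 4)) :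
    0 < Real.sin (bandX μ θ) * Real.sin (3 * bandY μ θ) - Real.sin (bandY μ θ) * Real.sin (3 * bandX μ θ) := by
  obtain ⟨h1, h2, h3⟩ := klfs_octant_point hμ₁ hμ₂ hθ
  exact klfs_cross_sin_three_mul_pos h1 h2 h3

/-- The same with the anchored leg written as `k* = 2πG - 3p` (`G ∈ ℤ²`): the determinant only changes sign
(`sin (2πGᵢ - 3pᵢ) = -sin 3pᵢ`), so it is strictly NEGATIVE, in particular non-zero. [folklore] -/
theorem klfs_corner_transversal_anchored {μ : ℝ} (hμ₁ : -4 < μ) (hμ₂ : μ < 0) {θ : ℝ}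
    (hθ : θ ∈ Ioo (0 : ℝ) (π / 4)) (G : Fin 2 → ℤ) :
    Real.sin (bandX μ θ) * Real.sin (2 * π * (G 1 : ℝ) - 3 * bandY μ θ) -
        Real.sin (bandY μ θ) * Real.sin (2 * π * (G 0 : ℝ) - 3 * bandX μ θ) < 0 := by
  have e1 : Real.sin (2 * π * (G 1 : ℝ) - 3 * bandY μ θ) = -Real.sin (3 * bandY μ θ) := by
    rw [show 2 * π * (G 1 : ℝ) - 3 * bandY μ θ = -(3 * bandY μ θ) + (G 1 : ℝ) * (2 * π) by ring,
      Real.sin_add_int_mul_two_pi, Real.sin_neg]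
  have e0 : Real.sin (2 * π * (G 0 : ℝ) - 3 * bandX μ θ) = -Real.sin (3 * bandX μ θ) := by
    rw [show 2 * π * (G 0 : ℝ) - 3 * bandX μ θ = -(3 * bandX μ θ) + (G 0 : ℝ) * (2 * π) by ring,
      Real.sin_add_int_mul_two_pi, Real.sin_neg]
  rw [e1, e0]
  have h := klfs_corner_transversal hμ₁ hμ₂ hθ
  linarith

/-- **On both windows every umklapp corner is strictly transversal**: there is a corner `θ* ∈ (0, π/4)`
(`klfs_windows_corner`) and at it `det(∇ε(p), ∇ε(3p)) > 0`. [folklore] -/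
theorem klfs_windows_corner_transversal {μ : ℝ}
    (hμ : μ ∈ Icc (-0.4267 : ℝ) (-0.1798) ∨ μ ∈ Icc (-1 : ℝ) (-0.15)) :
    ∃ θ ∈ Ioo (0 : ℝ) (π / 4), rayDispersion (θ, 3 * bandFermiRadius μ θ) = μ ∧
      π < ‖(3 * bandFermiRadius μ θ) • dir θ‖ ∧
      0 < Real.sin (bandX μ θ) * Real.sin (3 * bandY μ θ) - Real.sin (bandY μ θ) * Real.sin (3 * bandX μ θ) := by
  have hμ' : -4 < μ ∧ μ < 0 := by
    rcases hμ with h | h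
    · exact ⟨by linarith [h.1], by linarith [h.2]⟩
    · exact ⟨by linarith [h.1], by linarith [h.2]⟩
  obtain ⟨θ, hθ, he, hn⟩ := klfs_windows_corner hμ
  exact ⟨θ, hθ, he, hn, klfs_corner_transversal hμ'.1 hμ'.2 hθ⟩

/-! ### §4 The corner in CLOSED FORM

The two corner equations `cos x + cos y = m` (`p ∈ F_μ`, `m = -μ/2`) and `cos 3x + cos 3y = m`
(`3p ∈ F_μ + 2πℤ²`) are solvable: with `a = cos x`, `b = cos y` and `cos 3t = 4cos³t - 3cos t` they read
`a + b = m`, `a³ + b³ = m`, whence `ab = (m² - 1)/3` and `{a, b} = {(m ∓ s)/2}`, `s = √((4 - m²)/3)`.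
So the corner point of the first octant is `p₁ = (arccos ((m-s)/2), arccos ((m+s)/2))` — e.g. `μ = -1`:
`p₁ = (3π/5, π/5)` — it is UNIQUE, it exists iff `(m+s)/2 ≤ 1` iff `m ≤ 1` iff `μ ≥ -2` (the algebraic
form of `klfs_exists_corner` / `klfs_no_corner_of_lt_neg_two`), and the transversality factor is
`sin²x₁ - sin²y₁ = b² - a² = m·s = (-μ/2)√((4 - μ²/4)/3)` explicitly. -/

/-- **The corner algebra**: `a + b = m ≠ 0`, `(4a³ - 3a) + (4b³ - 3b) = m`, `a < b` force
`a = (m - s)/2`, `b = (m + s)/2` with `s = √((4 - m²)/3)`. [folklore] -/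
theorem klfs_corner_algebra {a b m : ℝ} (hm : m ≠ 0) (h1 : a + b = m)
    (h3 : (4 * a ^ 3 - 3 * a) + (4 * b ^ 3 - 3 * b) = m) (hab : a < b) :
    a = (m - Real.sqrt ((4 - m ^ 2) / 3)) / 2 ∧ b = (m + Real.sqrt ((4 - m ^ 2) / 3)) / 2 := by
  have hcube : a ^ 3 + b ^ 3 = m := by linarith
  have e : (a + b) ^ 3 = a ^ 3 + b ^ 3 + 3 * (a * b) * (a + b) := by ring
  rw [h1, hcube] at e
  have hprod : a * b = (m ^ 2 - 1) / 3 := by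
    have h : m * (3 * (a * b)) = m * (m ^ 2 - 1) := by linear_combination -e
    have := mul_left_cancel₀ hm h
    linarith
  have hsq : (b - a) ^ 2 = (4 - m ^ 2) / 3 := by
    have h : (b - a) ^ 2 = (a + b) ^ 2 - 4 * (a * b) := by ring
    rw [h, h1, hprod]; ring
  have hba : b - a = Real.sqrt ((4 - m ^ 2) / 3) := by
    rw [← hsq, Real.sqrt_sq (by linarith)]
  constructor <;> linarith [h1, hba]

/-- **The umklapp corner in closed form**: if `θ ∈ (0, π/4)` is a corner angle at level `-4 < μ < 0`
(`ε(3 p_μ(θ)) = μ`), then with `m = -μ/2`, `s = √((4 - m²)/3)` the corner point `p_μ(θ) = (x, y)` has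
`cos x = (m - s)/2` and `cos y = (m + s)/2`. [folklore] -/
theorem klfs_corner_cos_eq {μ : ℝ} (hμ₁ : -4 < μ) (hμ₂ : μ < 0) {θ : ℝ} (hθ : θ ∈ Ioo (0 : ℝ) (π / 4))
    (hcorner : rayDispersion (θ, 3 * bandFermiRadius μ θ) = μ) :
    Real.cos (bandX μ θ) = (-μ / 2 - Real.sqrt ((4 - (-μ / 2) ^ 2) / 3)) / 2 ∧
      Real.cos (bandY μ θ) = (-μ / 2 + Real.sqrt ((4 - (-μ / 2) ^ 2) / 3)) / 2 := by
  have hlev := BandSectorCounting.eps2_bandXY hμ₁ hμ₂ θ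
  unfold BandSectorCounting.eps2 at hlev
  rw [rayDispersion_eq] at hcorner
  have hx3 : 3 * bandFermiRadius μ θ * Real.cos θ = 3 * bandX μ θ := by unfold bandX; ring
  have hy3 : 3 * bandFermiRadius μ θ * Real.sin θ = 3 * bandY μ θ := by unfold bandY; ring
  simp only [hx3, hy3, Real.cos_three_mul] at hcorner
  obtain ⟨h1, h2, h3⟩ := klfs_octant_point hμ₁ hμ₂ hθ
  have hcos : Real.cos (bandX μ θ) < Real.cos (bandY μ θ) :=
    Real.cos_lt_cos_of_nonneg_of_le_pi h1.le (by linarith) h2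
  exact klfs_corner_algebra (by linarith : -μ / 2 ≠ 0) (by linarith) (by linarith) hcos

/-- **The corner transversality factor in closed form**: at a corner,
`sin²x - sin²y = (-μ/2)·√((4 - μ²/4)/3)`. [folklore] -/
theorem klfs_corner_transversality_factor {μ : ℝ} (hμ₁ : -4 < μ) (hμ₂ : μ < 0) {θ : ℝ}
    (hθ : θ ∈ Ioo (0 : ℝ) (π / 4)) (hcorner : rayDispersion (θ, 3 * bandFermiRadius μ θ) = μ) :
    Real.sin (bandX μ θ) ^ 2 - Real.sin (bandY μ θ) ^ 2 =
      (-μ / 2) * Real.sqrt ((4 - (-μ / 2) ^ 2) / 3) := by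
  obtain ⟨ha, hb⟩ := klfs_corner_cos_eq hμ₁ hμ₂ hθ hcorner
  rw [Real.sin_sq, Real.sin_sq, ha, hb]
  ring

/-- **The corner determinant in closed form**: at a corner,
`sin x sin 3y - sin y sin 3x = 4 sin x sin y · (-μ/2)√((4 - μ²/4)/3)`. [folklore] -/
theorem klfs_corner_det_eq {μ : ℝ} (hμ₁ : -4 < μ) (hμ₂ : μ < 0) {θ : ℝ}
    (hθ : θ ∈ Ioo (0 : ℝ) (π / 4)) (hcorner : rayDispersion (θ, 3 * bandFermiRadius μ θ) = μ) :
    Real.sin (bandX μ θ) * Real.sin (3 * bandY μ θ) - Real.sin (bandY μ θ) * Real.sin (3 * bandX μ θ) =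
      4 * Real.sin (bandX μ θ) * Real.sin (bandY μ θ) * ((-μ / 2) * Real.sqrt ((4 - (-μ / 2) ^ 2) / 3)) := by
  rw [klfs_cross_sin_three_mul, klfs_corner_transversality_factor hμ₁ hμ₂ hθ hcorner]

/-- **The corner point in closed form**: `x = arccos ((m - s)/2)`, `y = arccos ((m + s)/2)` (`x, y ∈ (0, π)`).
[folklore] -/
theorem klfs_corner_point_eq {μ : ℝ} (hμ₁ : -4 < μ) (hμ₂ : μ < 0) {θ : ℝ} (hθ : θ ∈ Ioo (0 : ℝ) (π / 4))
    (hcorner : rayDispersion (θ, 3 * bandFermiRadius μ θ) = μ) :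
    bandX μ θ = Real.arccos ((-μ / 2 - Real.sqrt ((4 - (-μ / 2) ^ 2) / 3)) / 2) ∧
      bandY μ θ = Real.arccos ((-μ / 2 + Real.sqrt ((4 - (-μ / 2) ^ 2) / 3)) / 2) := by
  obtain ⟨ha, hb⟩ := klfs_corner_cos_eq hμ₁ hμ₂ hθ hcorner
  obtain ⟨h1, h2, h3⟩ := klfs_octant_point hμ₁ hμ₂ hθ
  constructor
  · rw [← ha, Real.arccos_cos (by linarith) (by linarith)]
  · rw [← hb, Real.arccos_cos h1.le (by linarith)]

/-- **Uniqueness of the corner angle** in the first octant: two corner angles `θ, θ' ∈ (0, π/4)` at the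
same level coincide (the corner point is determined in closed form, and a point of the first quadrant
determines its polar angle). [folklore] -/
theorem klfs_corner_unique {μ : ℝ} (hμ₁ : -4 < μ) (hμ₂ : μ < 0) {θ θ' : ℝ}
    (hθ : θ ∈ Ioo (0 : ℝ) (π / 4)) (hθ' : θ' ∈ Ioo (0 : ℝ) (π / 4))
    (hc : rayDispersion (θ, 3 * bandFermiRadius μ θ) = μ)
    (hc' : rayDispersion (θ', 3 * bandFermiRadius μ θ') = μ) : θ = θ' := by
  obtain ⟨hx, hy⟩ := klfs_corner_point_eq hμ₁ hμ₂ hθ hc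
  obtain ⟨hx', hy'⟩ := klfs_corner_point_eq hμ₁ hμ₂ hθ' hc'
  have hX : bandX μ θ = bandX μ θ' := by rw [hx, hx']
  have hY : bandY μ θ = bandY μ θ' := by rw [hy, hy']
  have hu := bandFermiRadius_pos hμ₁ hμ₂ θ
  have hu' := bandFermiRadius_pos hμ₁ hμ₂ θ'
  -- equal points with positive radii: `u² = u'²`, hence `u = u'`, hence `cos θ = cos θ'`
  have hsq : bandFermiRadius μ θ ^ 2 = bandFermiRadius μ θ' ^ 2 := by
    have e1 : bandFermiRadius μ θ ^ 2 = bandX μ θ ^ 2 + bandY μ θ ^ 2 := by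
      unfold bandX bandY; nlinarith [Real.sin_sq_add_cos_sq θ]
    have e2 : bandFermiRadius μ θ' ^ 2 = bandX μ θ' ^ 2 + bandY μ θ' ^ 2 := by
      unfold bandX bandY; nlinarith [Real.sin_sq_add_cos_sq θ']
    rw [e1, e2, hX, hY]
  have hueq : bandFermiRadius μ θ = bandFermiRadius μ θ' := by
    nlinarith [hsq, hu, hu']
  have hcos : Real.cos θ = Real.cos θ' := by
    unfold bandX at hX; rw [hueq] at hX; exact mul_left_cancel₀ hu'.ne' hX
  exact Real.injOn_cos ⟨hθ.1.le, by linarith [hθ.2, Real.pi_pos]⟩ ⟨hθ'.1.le, by linarith [hθ'.2, Real.pi_pos]⟩ hcos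

/-- **Quantitative transversality on the two windows**: at the corner of `klfs_windows_corner`,
`sin²x₁ - sin²y₁ ≥ 0.103` on the certified window `μ ∈ [-0.4267, -0.1798]` and `≥ 0.083` on the analysis
window `[-1, -0.15]` (`m·s` with `m ≥ 0.0899`, `s ≥ 1.148`, resp. `m ≥ 0.075`, `s ≥ 1.118`). [folklore] -/
theorem klfs_windows_corner_transversality_factor_ge {μ : ℝ}
    (hμ : μ ∈ Icc (-0.4267 : ℝ) (-0.1798) ∨ μ ∈ Icc (-1 : ℝ) (-0.15)) {θ : ℝ}
    (hθ : θ ∈ Ioo (0 : ℝ) (π / 4)) (hcorner : rayDispersion (θ, 3 * bandFermiRadius μ θ) = μ) :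
    (μ ∈ Icc (-0.4267 : ℝ) (-0.1798) → (0.103 : ℝ) ≤ Real.sin (bandX μ θ) ^ 2 - Real.sin (bandY μ θ) ^ 2) ∧
    (μ ∈ Icc (-1 : ℝ) (-0.15) → (0.083 : ℝ) ≤ Real.sin (bandX μ θ) ^ 2 - Real.sin (bandY μ θ) ^ 2) := by
  have hμ' : -4 < μ ∧ μ < 0 := by
    rcases hμ with h | h
    · exact ⟨by linarith [h.1], by linarith [h.2]⟩
    · exact ⟨by linarith [h.1], by linarith [h.2]⟩
  rw [klfs_corner_transversality_factor hμ'.1 hμ'.2 hθ hcorner]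
  constructor
  · intro h
    have hs : (1.148 : ℝ) ≤ Real.sqrt ((4 - (-μ / 2) ^ 2) / 3) := by
      refine Real.le_sqrt_of_sq_le ?_
      nlinarith [h.1, h.2]
    have hm : (0.0899 : ℝ) ≤ -μ / 2 := by linarith [h.2]
    nlinarith [mul_nonneg (sub_nonneg.2 hm) (sub_nonneg.2 hs)]
  · intro h
    have hs : (1.118 : ℝ) ≤ Real.sqrt ((4 - (-μ / 2) ^ 2) / 3) := by
      refine Real.le_sqrt_of_sq_le ?_
      nlinarith [h.1, h.2]
    have hm : (0.075 : ℝ) ≤ -μ / 2 := by linarith [h.2]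
    nlinarith [mul_nonneg (sub_nonneg.2 hm) (sub_nonneg.2 hs)]

end Summit.HubbardSuperconductivity.HubbardSuperconductivity.Theorems

end
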